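import Summits.QuantumFields.BalabanUV.T4Continuum.Support.NE7LatticeUhlenbeckSteps
import Mathlib.Analysis.Real.Pi.Bounds
import HarnessLib

/-!
# NE7 — THE ONE-SCALE LATTICE UHLENBECK LEMMA ON A BOX, SUP FORM: the links `e^{B}` on `periodBox (m+1) ⊂ ℤᵈ` whose deformations `e^{sB}` have
# plaquettes within `ε′` of `1` admit, in the regime `576·(64d³M)²·ε′ ≤ 1`, `n(1 + 2dM)·256d³Mε′ ≤ ½` (`M = m+1`), a unitary pinned site gauge in
# which they read `e^{A}`, `A` skew, `‖A‖ ≤ 128·d³·M·ε′`, satisfying the free-boundary lattice Landau condition at every site — the constants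
# `θ`, `N` of the incremental construction chosen explicitly and (C1)–(C4) verified (F313c)

Cell `pub-balaban`, rung (B)+1 sub-cell t4, lineage `b2b-balaban-t4-ne7-p1` (CRUX PROVER NE7 #1 = OWNER of row NE7), generation 93; memo
`t4/b2b-balaban-t4-ne7-p1-g93/UHLENBECK-ROAD.md` §6.  Over F313b `NE7LatticeUhlenbeckSteps.uhlenbeck_box_of_steps`.

CHOICES.  `ρ⋆ = 256d³Mε′` (four times the a priori constant of F309b at `ε′`); `θ = min(1∕(4096·n·d³·m²·M^d), ρ⋆∕300)`; `N = ⌈101·n·d³·m²·M^d·b₀∕θ⌉ + 1`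
(`b₀ ≥ ‖B‖`).  Then (C2) is `144·64d³M·ρ⋆ ≤ 1`, i.e. the first regime hypothesis; (C1) and (C3) follow from `e^{x} ≤ 1 + x + x²`, `e^{x} ≤ 1 + 2x`
(`0 ≤ x ≤ 1`), `π < 3.15` and the second regime hypothesis; (C4) from the choice of `θ` and `N`.  Only the two regime hypotheses are uniform in `M`
(they read `M²ε′ ≪ 1`); `θ` and `N` depend on `M`, `n`, `d`, `b₀` — harmless, they are internal to the construction.

WHAT ([folklore]; 0 def, 0 sorry): **`uhlenbeck_box`** (the elementary bounds `e^x ≤ 1 + 2x`, `e^x ≤ 1 + x + x²` on `[0,1]` are inlined).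
HONEST FRAMING (page 1): a lattice-gauge lemma for ARBITRARY skew `B` on a box of `ℤᵈ`; nothing of Bałaban's asserted; NE7 NOT PROVED here; spine 0∕9;
finite T⁴ rung (B)+1 — NOT infinite volume, NOT mass gap, NOT `BetaPertH`, NOT Clay.  No `sorry`; axioms ⊆ {propext, Classical.choice, Quot.sound}.
-/

set_option autoImplicit false

open scoped BigOperators Matrix Matrix.Norms.L2Operator
open Finset NormedSpace Set

namespace Summit.QuantumFields.BalabanUV.T4Continuum.NE7LatticeUhlenbeckBox

open Literature.MathematicalPhysics.QuantumFieldTheory.Balaban1983to89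
open B7Prop1Explicit UnitaryModel MatrixNorms
open T4AveragingDeficitWallBoundary (periodBox mem_periodBox)
open NE7LatticeUhlenbeckSteps (uhlenbeck_box_of_steps)

noncomputable section

variable {d : ℕ} {n : Type*} [Fintype n] [DecidableEq n] [Nonempty n]

/-! ## §1 The lattice Uhlenbeck lemma on a box -/

set_option maxHeartbeats 3200000 in
/-- **THE ONE-SCALE LATTICE UHLENBECK LEMMA ON A BOX, SUP FORM** (`d ≥ 1`, `m ≥ 1`, `M = m+1`).  Let `B` be a skew bond field with `‖B‖ ≤ b₀` whose
deformations `e^{sB}`, `s ∈ [0,1]`, have all box plaquettes within `ε′ > 0` of `1`, in the regime `576·(64d³M)²·ε′ ≤ 1` and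
`n·(1 + 2dM)·(256d³Mε′) ≤ ½`.  Then there are a unitary site gauge `g` (`= 1` off the box, `g 0 = 1`) and a skew `A` with
`e^{A(x,κ)} = g_x e^{B(x,κ)} g_{x+e_κ}ᴴ` on the box bonds, `‖A‖ ≤ 128d³Mε′`, satisfying the free-boundary lattice Landau condition at every box site.
[folklore] -/
theorem uhlenbeck_box (hd : 1 ≤ d) {m : ℕ} (hm : 1 ≤ m) (B : Site d → Fin d → Matrix n n ℂ)
    (hBskew : ∀ x κ, B x κ ∈ skewAdjoint (Matrix n n ℂ)) {b₀ : ℝ} (hB : ∀ x κ, ‖B x κ‖ ≤ b₀) {ε' : ℝ} (hε' : 0 < ε')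
    (hplaq : ∀ s ∈ Icc (0 : ℝ) 1, ∀ (q : Site d) (μ ν : Fin d), μ ≠ ν → q ∈ periodBox (d := d) (m + 1) → q + e μ ∈ periodBox (d := d) (m + 1) →
      q + e ν ∈ periodBox (d := d) (m + 1) → q + e μ + e ν ∈ periodBox (d := d) (m + 1) →
      ‖exp ((s : ℂ) • B q μ) * exp ((s : ℂ) • B (q + e μ) ν) * (exp ((s : ℂ) • B (q + e ν) μ))ᴴ * (exp ((s : ℂ) • B q ν))ᴴ - 1‖ ≤ ε')
    (hR1 : 576 * (64 * (d : ℝ) ^ 3 * ((m + 1 : ℕ) : ℝ)) ^ 2 * ε' ≤ 1)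
    (hR2 : (Fintype.card n : ℝ) * (1 + 2 * d * ((m + 1 : ℕ) : ℝ)) * (256 * (d : ℝ) ^ 3 * ((m + 1 : ℕ) : ℝ) * ε') ≤ 1 / 2) :
    ∃ (g : Site d → Matrix n n ℂ) (A : Site d → Fin d → Matrix n n ℂ), (∀ x, g x ∈ Matrix.unitaryGroup n ℂ) ∧
      (∀ x, x ∉ periodBox (d := d) (m + 1) → g x = 1) ∧ g 0 = 1 ∧
      (∀ (x : Site d) (κ : Fin d), x ∈ periodBox (d := d) (m + 1) → x + e κ ∈ periodBox (d := d) (m + 1) → A x κ ∈ skewAdjoint (Matrix n n ℂ)) ∧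
      (∀ (x : Site d) (κ : Fin d), x ∈ periodBox (d := d) (m + 1) → x + e κ ∈ periodBox (d := d) (m + 1) →
        exp (A x κ) = g x * exp (B x κ) * (g (x + e κ))ᴴ) ∧
      (∀ (x : Site d) (κ : Fin d), x ∈ periodBox (d := d) (m + 1) → x + e κ ∈ periodBox (d := d) (m + 1) →
        ‖A x κ‖ ≤ 128 * (d : ℝ) ^ 3 * ((m + 1 : ℕ) : ℝ) * ε') ∧
      (∀ y ∈ periodBox (d := d) (m + 1), ∑ κ : Fin d,
        ((if y + e κ ∈ periodBox (d := d) (m + 1) then (exp (A y κ) - exp (-A y κ)) else 0)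
          - (if y - e κ ∈ periodBox (d := d) (m + 1) then (exp (A (y - e κ) κ) - exp (-A (y - e κ) κ)) else 0)) = 0) := by
  -- the constants
  set Nn : ℝ := (Fintype.card n : ℝ) with hNn
  set D : ℝ := (d : ℝ) with hD
  set M : ℝ := ((m + 1 : ℕ) : ℝ) with hM
  set K : ℝ := 64 * D ^ 3 * M with hK
  set ρs : ℝ := 256 * D ^ 3 * M * ε' with hρs
  have hNn1 : 1 ≤ Nn := by rw [hNn]; exact_mod_cast Fintype.card_pos
  have hD1 : 1 ≤ D := by rw [hD]; exact_mod_cast hd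
  have hm1 : (1 : ℝ) ≤ m := by exact_mod_cast hm
  have hM2 : 2 ≤ M := by rw [hM]; push_cast; linarith
  have hb₀ : 0 ≤ b₀ := (norm_nonneg _).trans (hB 0 ⟨0, hd⟩)
  have hD3 : 1 ≤ D ^ 3 := one_le_pow₀ hD1
  have hm2 : (1 : ℝ) ≤ (m : ℝ) ^ 2 := one_le_pow₀ hm1
  have hK64 : 64 ≤ K := by rw [hK]; nlinarith
  have hK0 : 0 < K := by linarith
  have hρs_eq : ρs = 4 * K * ε' := by rw [hρs, hK]; ring
  have hρs0 : 0 < ρs := by rw [hρs_eq]; positivity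
  -- (C2) and `ρ⋆ ≤ 1/144`
  have h144 : 144 * K * ρs ≤ 1 := by
    rw [hρs_eq]; have : 144 * K * (4 * K * ε') = 576 * K ^ 2 * ε' := by ring
    rw [this, hK, hD, hM]; exact hR1
  have hρs144 : ρs ≤ 1 / 144 := by
    have : 144 * ρs ≤ 144 * K * ρs := by nlinarith
    linarith
  have hρs4 : ρs ≤ 1 / 4 := by linarith
  have hC2 : 64 * (d : ℝ) ^ 3 * ((m + 1 : ℕ) : ℝ) * (ε' + 36 * ρs ^ 2) ≤ ρs / 2 := by
    rw [← hD, ← hM, show 64 * D ^ 3 * M = K by rw [hK]]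
    have h1 : K * ε' = ρs / 4 := by rw [hρs_eq]; ring
    have h2 : K * (36 * ρs ^ 2) ≤ ρs / 4 := by
      have : K * (36 * ρs ^ 2) = (144 * K * ρs) * (ρs / 4) := by ring
      rw [this]; nlinarith
    nlinarith
  -- the volume factor, the ball radius, the step number
  set Vd : ℝ := M ^ d with hVd
  have hVd1 : 1 ≤ Vd := by rw [hVd]; exact one_le_pow₀ (by linarith)
  set P : ℝ := Nn * D ^ 3 * (m : ℝ) ^ 2 * Vd with hP
  have hP1 : 1 ≤ P := by
    rw [hP]
    calc (1 : ℝ) = 1 * 1 * 1 * 1 := by ring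
      _ ≤ Nn * D ^ 3 * (m : ℝ) ^ 2 * Vd :=
        mul_le_mul (mul_le_mul (mul_le_mul hNn1 hD3 zero_le_one (by linarith)) hm2 zero_le_one (by positivity)) hVd1 zero_le_one (by positivity)
  have hP0 : 0 < P := by linarith
  set θ : ℝ := min (1 / (4096 * P)) (ρs / 300) with hθ_def
  have hθ0 : 0 < θ := lt_min (by positivity) (by positivity)
  have hθ1 : θ ≤ 1 / (4096 * P) := min_le_left _ _
  have hθ2 : θ ≤ ρs / 300 := min_le_right _ _
  have hθsmall : θ ≤ 1 / 4096 := hθ1.trans (one_div_le_one_div_of_le (by norm_num) (by nlinarith))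
  have hθP : θ * P ≤ 1 / 4096 := by
    have h := hθ1; rw [le_div_iff₀ (by positivity)] at h; linarith
  set Nst : ℕ := ⌈101 * P * b₀ / θ⌉₊ + 1 with hNst
  have hNst1 : 1 ≤ Nst := by omega
  have hNstR : 101 * P * b₀ / θ ≤ (Nst : ℝ) := by
    rw [hNst]; push_cast
    exact (Nat.le_ceil _).trans (by linarith)
  have hNst0 : (0 : ℝ) < Nst := by exact_mod_cast hNst1
  -- `δ b₀ = b₀ / N`: `101 P δb₀ ≤ θ`
  set db : ℝ := 1 / (Nst : ℝ) * b₀ with hdb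
  have hdb0 : 0 ≤ db := by positivity
  have hdbP : 101 * P * db ≤ θ := by
    rw [hdb]
    have h1 : 101 * P * b₀ ≤ θ * (Nst : ℝ) := by
      have h := hNstR; rw [div_le_iff₀ hθ0] at h; linarith
    have h2 : 101 * P * (1 / (Nst : ℝ) * b₀) = (101 * P * b₀) / (Nst : ℝ) := by ring
    rw [h2, div_le_iff₀ hNst0]; linarith
  have hdbθ : db ≤ θ := by nlinarith
  have hdb1 : db ≤ 1 := by linarith
  -- exponential letters (all linear in `θ`, `ρs`, `db` after the product bounds below)
  have hpi : Real.pi / 2 ≤ 1.575 := by linarith [Real.pi_lt_d2]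
  have hpi0 : 0 < Real.pi / 2 := by positivity
  have hπθ : Real.pi / 2 * θ ≤ 1.575 * θ := mul_le_mul_of_nonneg_right hpi hθ0.le
  have hπθ0 : 0 ≤ Real.pi / 2 * θ := by positivity
  have hρρ : ρs * ρs ≤ ρs * (1 / 144) := mul_le_mul_of_nonneg_left hρs144 hρs0.le
  have hθρ : θ * ρs ≤ (1 / 4096) * ρs := mul_le_mul_of_nonneg_right hθsmall hρs0.le
  have hθθ : θ * θ ≤ θ * (1 / 4096) := mul_le_mul_of_nonneg_left hθsmall hθ0.le
  have hexp2 : ∀ x : ℝ, 0 ≤ x → x ≤ 1 → Real.exp x ≤ 1 + 2 * x := fun x h0 h1 => by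
    have h := Real.abs_exp_sub_one_le (x := x) (by rw [abs_of_nonneg h0]; exact h1)
    rw [abs_of_nonneg h0] at h
    linarith [le_abs_self (Real.exp x - 1)]
  have hexpq : ∀ x : ℝ, 0 ≤ x → x ≤ 1 → Real.exp x ≤ 1 + x + x ^ 2 := fun x h0 h1 => by
    have h := Real.abs_exp_sub_one_sub_id_le (x := x) (by rw [abs_of_nonneg h0]; exact h1)
    linarith [le_abs_self (Real.exp x - 1 - x)]
  have hE1 : Real.exp (ρs / 2) ≤ 1 + ρs / 2 + (ρs / 2) ^ 2 := hexpq _ (by positivity) (by linarith)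
  have hE1' : Real.exp (ρs / 2) ≤ 1 + 0.51 * ρs := by
    have : (ρs / 2) ^ 2 = ρs * ρs / 4 := by ring
    linarith
  have hE2 : Real.exp db ≤ 1 + 2 * db := hexp2 _ hdb0 hdb1
  have hE2' : Real.exp db ≤ 1 + 2 * θ := by linarith
  have hE3 : Real.exp (2 * (Real.pi / 2 * θ)) ≤ 1 + 2 * (2 * (Real.pi / 2 * θ)) := hexp2 _ (by positivity) (by linarith)
  have hE3' : Real.exp (2 * (Real.pi / 2 * θ)) ≤ 1 + 6.3 * θ := by linarith
  have hE1pos : 0 < Real.exp (ρs / 2) := Real.exp_pos _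
  have hE2pos : 0 < Real.exp db := Real.exp_pos _
  have hE3pos : 0 < Real.exp (2 * (Real.pi / 2 * θ)) := Real.exp_pos _
  have hE1ge : 1 ≤ Real.exp (ρs / 2) := Real.one_le_exp (by positivity)
  have hE2ge : 1 ≤ Real.exp db := Real.one_le_exp hdb0
  have hE3ge : 1 ≤ Real.exp (2 * (Real.pi / 2 * θ)) := Real.one_le_exp (by positivity)
  -- `E1·E2 ≤ 1 + 0.52 ρs`
  have hP12 : Real.exp (ρs / 2) * Real.exp db ≤ 1 + 0.52 * ρs := by
    have h1 : Real.exp (ρs / 2) * Real.exp db ≤ (1 + 0.51 * ρs) * (1 + 2 * θ) := mul_le_mul hE1' hE2' hE2pos.le (by positivity)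
    have h2 : (1 + 0.51 * ρs) * (1 + 2 * θ) = 1 + 2 * θ + 0.51 * ρs + 1.02 * (θ * ρs) := by ring
    linarith
  have hP12ge : 1 ≤ Real.exp (ρs / 2) * Real.exp db := by
    calc (1 : ℝ) = 1 * 1 := by ring
      _ ≤ _ := mul_le_mul hE1ge hE2ge zero_le_one hE1pos.le
  -- (C1)
  have hC1 : Real.pi / 2 * ((1 + θ) * (Real.exp (ρs / 2) * Real.exp db) * (1 + θ) - 1) ≤ ρs := by
    have h1 : (1 + θ) * (Real.exp (ρs / 2) * Real.exp db) * (1 + θ) ≤ (1 + θ) * (1 + 0.52 * ρs) * (1 + θ) :=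
      mul_le_mul_of_nonneg_right (mul_le_mul_of_nonneg_left hP12 (by positivity)) (by positivity)
    have h2 : (1 + θ) * (1 + 0.52 * ρs) * (1 + θ) = 1 + 2 * θ + θ * θ + 0.52 * ρs + 1.04 * (θ * ρs) + 0.52 * (θ * θ * ρs) := by ring
    have h3 : θ * θ * ρs ≤ θ * (1 / 4096) * (1 / 144) := by
      calc θ * θ * ρs ≤ θ * (1 / 4096) * ρs := mul_le_mul_of_nonneg_right hθθ hρs0.le
        _ ≤ θ * (1 / 4096) * (1 / 144) := mul_le_mul_of_nonneg_left hρs144 (by positivity)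
    have h4 : (1 + θ) * (Real.exp (ρs / 2) * Real.exp db) * (1 + θ) - 1 ≤ 0.54 * ρs := by linarith
    have h5 : 0 ≤ (1 + θ) * (Real.exp (ρs / 2) * Real.exp db) * (1 + θ) - 1 := by
      have : 1 ≤ (1 + θ) * (Real.exp (ρs / 2) * Real.exp db) * (1 + θ) := by
        calc (1 : ℝ) = 1 * 1 * 1 := by ring
          _ ≤ (1 + θ) * (Real.exp (ρs / 2) * Real.exp db) * (1 + θ) :=
            mul_le_mul (mul_le_mul (by linarith) hP12ge zero_le_one (by positivity)) (by linarith) zero_le_one (by positivity)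
      linarith
    calc Real.pi / 2 * ((1 + θ) * (Real.exp (ρs / 2) * Real.exp db) * (1 + θ) - 1)
        ≤ 1.575 * (0.54 * ρs) := mul_le_mul hpi h4 h5 (by norm_num)
      _ ≤ ρs := by linarith
  -- (C3)
  have hW : Real.exp (2 * (Real.pi / 2 * θ)) * (1 + (Real.exp (ρs / 2) * Real.exp db - 1)) - 1 ≤ 0.56 * ρs := by
    rw [show (1 + (Real.exp (ρs / 2) * Real.exp db - 1)) = Real.exp (ρs / 2) * Real.exp db by ring]
    have h1 : Real.exp (2 * (Real.pi / 2 * θ)) * (Real.exp (ρs / 2) * Real.exp db) ≤ (1 + 6.3 * θ) * (1 + 0.52 * ρs) :=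
      mul_le_mul hE3' hP12 (by positivity) (by positivity)
    have h2 : (1 + 6.3 * θ) * (1 + 0.52 * ρs) = 1 + 6.3 * θ + 0.52 * ρs + 3.276 * (θ * ρs) := by ring
    linarith
  have hC3 : (Fintype.card n : ℝ) * (Real.exp (2 * (Real.pi / 2 * θ)) * (1 + (Real.exp (ρs / 2) * Real.exp db - 1)) - 1)
      + 2 * (Fintype.card n : ℝ) * d * (m + 1) * (Real.exp (2 * (Real.pi / 2 * θ)) * (1 + (Real.exp (ρs / 2) * Real.exp db - 1)) - 1)
        ≤ 1 / 2 := by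
    rw [← hNn, ← hD]
    have hM' : ((m : ℝ) + 1) = M := by rw [hM]; push_cast; ring
    rw [hM']
    have hreg : Nn * (1 + 2 * D * M) * ρs ≤ 1 / 2 := by rw [hρs, hNn, hD, hM]; exact hR2
    set w := Real.exp (2 * (Real.pi / 2 * θ)) * (1 + (Real.exp (ρs / 2) * Real.exp db - 1)) - 1 with hw
    have h1 : Nn * w + 2 * Nn * D * M * w = Nn * (1 + 2 * D * M) * w := by ring
    rw [h1]
    have h2 : Nn * (1 + 2 * D * M) * w ≤ Nn * (1 + 2 * D * M) * (0.56 * ρs) := mul_le_mul_of_nonneg_left hW (by positivity)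
    have h3 : Nn * (1 + 2 * D * M) * (0.56 * ρs) = 0.56 * (Nn * (1 + 2 * D * M) * ρs) := by ring
    linarith
  -- (C4)
  have hC4 : (1 / 2) * (((m + 1 : ℕ) : ℝ) ^ d * ((Real.pi / 2 * θ) * (4 * d * (Real.exp db - 1))))
      + (1 / 2) * ((Real.pi / 2 * θ) ^ 2 * ((m + 1 : ℕ) : ℝ) ^ d * ((4 * d * (Real.exp db - 1))
        + 4 * d * ((1 + (Real.exp (ρs / 2) * Real.exp db - 1)) * (Real.exp (2 * (Real.pi / 2 * θ)) - 1))))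
      < θ ^ 2 / (4 * (Fintype.card n : ℝ) * d ^ 2 * m ^ 2) := by
    rw [← hNn, ← hD, ← hM, ← hVd]
    have he₀ : 4 * D * (Real.exp db - 1) ≤ 8 * D * db := by nlinarith [hE2]
    have he₀0 : 0 ≤ 4 * D * (Real.exp db - 1) := by nlinarith [hE2ge]
    have hv : (1 + (Real.exp (ρs / 2) * Real.exp db - 1)) ≤ 2 := by linarith
    have hv0 : 0 ≤ (1 + (Real.exp (ρs / 2) * Real.exp db - 1)) := by linarith
    have hq : Real.exp (2 * (Real.pi / 2 * θ)) - 1 ≤ 6.3 * θ := by linarith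
    have hq0 : 0 ≤ Real.exp (2 * (Real.pi / 2 * θ)) - 1 := by linarith
    -- the unit `Q = θ² / (Nn D² m²)` and the two key products
    set Q : ℝ := θ ^ 2 / (Nn * D ^ 2 * (m : ℝ) ^ 2) with hQ
    have hQden : 0 < Nn * D ^ 2 * (m : ℝ) ^ 2 := by positivity
    have hQ0 : 0 < Q := by positivity
    have hVdb : D * θ * (Vd * db) ≤ Q / 101 := by
      -- `101·P·db ≤ θ` with `P = Nn D³ m² Vd`
      rw [hQ, le_div_iff₀ (by norm_num : (0 : ℝ) < 101), le_div_iff₀ hQden]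
      have h1 : D * θ * (Vd * db) * 101 * (Nn * D ^ 2 * (m : ℝ) ^ 2) = θ * (101 * P * db) := by rw [hP]; ring
      rw [h1, sq]
      exact mul_le_mul_of_nonneg_left hdbP hθ0.le
    have hVθ : θ * (D * θ * (Vd * θ)) ≤ Q / 4096 := by
      rw [hQ, le_div_iff₀ (by norm_num : (0 : ℝ) < 4096), le_div_iff₀ hQden]
      have h1 : θ * (D * θ * (Vd * θ)) * 4096 * (Nn * D ^ 2 * (m : ℝ) ^ 2) = θ ^ 2 * (4096 * (θ * P)) := by rw [hP]; ring
      rw [h1]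
      have h2 : 4096 * (θ * P) ≤ 1 := by linarith
      nlinarith [sq_nonneg θ]
    -- term 1
    have hT1 : (1 / 2) * (Vd * ((Real.pi / 2 * θ) * (4 * D * (Real.exp db - 1)))) ≤ 0.063 * Q := by
      have h1 : (Real.pi / 2 * θ) * (4 * D * (Real.exp db - 1)) ≤ (1.575 * θ) * (8 * D * db) :=
        mul_le_mul hπθ he₀ he₀0 (by positivity)
      have h2 : (1 / 2) * (Vd * ((Real.pi / 2 * θ) * (4 * D * (Real.exp db - 1)))) ≤ (1 / 2) * (Vd * ((1.575 * θ) * (8 * D * db))) :=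
        mul_le_mul_of_nonneg_left (mul_le_mul_of_nonneg_left h1 (by positivity)) (by norm_num)
      have h3 : (1 / 2) * (Vd * ((1.575 * θ) * (8 * D * db))) = 6.3 * (D * θ * (Vd * db)) := by ring
      linarith
    -- term 2
    have hT2 : (1 / 2) * ((Real.pi / 2 * θ) ^ 2 * Vd * ((4 * D * (Real.exp db - 1))
        + 4 * D * ((1 + (Real.exp (ρs / 2) * Real.exp db - 1)) * (Real.exp (2 * (Real.pi / 2 * θ)) - 1)))) ≤ 0.02 * Q := by
      have h1 : 4 * D * ((1 + (Real.exp (ρs / 2) * Real.exp db - 1)) * (Real.exp (2 * (Real.pi / 2 * θ)) - 1)) ≤ 4 * D * (2 * (6.3 * θ)) :=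
        mul_le_mul_of_nonneg_left (mul_le_mul hv hq hq0 (by norm_num)) (by positivity)
      have h2 : (Real.pi / 2 * θ) ^ 2 ≤ (1.575 * θ) ^ 2 := pow_le_pow_left₀ hπθ0 hπθ 2
      have hsum : (4 * D * (Real.exp db - 1)) + 4 * D * ((1 + (Real.exp (ρs / 2) * Real.exp db - 1)) * (Real.exp (2 * (Real.pi / 2 * θ)) - 1))
          ≤ 8 * D * db + 50.4 * D * θ := by linarith
      have hsum0 : 0 ≤ (4 * D * (Real.exp db - 1)) + 4 * D * ((1 + (Real.exp (ρs / 2) * Real.exp db - 1)) * (Real.exp (2 * (Real.pi / 2 * θ)) - 1)) :=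
        add_nonneg he₀0 (by positivity)
      have h3 : (Real.pi / 2 * θ) ^ 2 * Vd * ((4 * D * (Real.exp db - 1))
          + 4 * D * ((1 + (Real.exp (ρs / 2) * Real.exp db - 1)) * (Real.exp (2 * (Real.pi / 2 * θ)) - 1)))
          ≤ (1.575 * θ) ^ 2 * Vd * (8 * D * db + 50.4 * D * θ) :=
        mul_le_mul (mul_le_mul_of_nonneg_right h2 (by positivity)) hsum hsum0 (by positivity)
      have h4 : (1 / 2) * ((1.575 * θ) ^ 2 * Vd * (8 * D * db + 50.4 * D * θ))
          = 1.575 ^ 2 * 4 * (θ * (D * θ * (Vd * db))) + 1.575 ^ 2 * 25.2 * (θ * (D * θ * (Vd * θ))) := by ring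
      have h5 : θ * (D * θ * (Vd * db)) ≤ (1 / 4096) * (Q / 101) :=
        mul_le_mul hθsmall hVdb (by positivity) (by norm_num)
      have h7 : (1 / 2) * ((1.575 * θ) ^ 2 * Vd * (8 * D * db + 50.4 * D * θ)) ≤ 0.02 * Q := by
        rw [h4]; nlinarith [hVθ, h5, hQ0]
      linarith
    have hgoal : θ ^ 2 / (4 * Nn * D ^ 2 * (m : ℝ) ^ 2) = 0.25 * Q := by rw [hQ]; field_simp; ring
    rw [hgoal]
    linarith
  -- run the construction
  obtain ⟨g, A, hgu, hg1, hg0, hAskew, hAexp, hAρ, hEL⟩ := uhlenbeck_box_of_steps (n := n) hd hm B hBskew hB (ε' := ε') (ρs := ρs) (θ := θ)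
    (N := Nst) hNst1 hε'.le hρs0.le hρs4 hθ0 hplaq hC1 hC2 hC3 hC4
  refine ⟨g, A, hgu, hg1, hg0, hAskew, hAexp, fun x κ hx hxκ => (hAρ x κ hx hxκ).trans (le_of_eq ?_), hEL⟩
  rw [hρs, hD, hM]; ring

end

end Summit.QuantumFields.BalabanUV.T4Continuum.NE7LatticeUhlenbeckBox
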